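import Literature.NumberTheory.EllipticCurves.CuspFormTwistRatPlusSymbol
import Literature.NumberTheory.EllipticCurves.EichlerShimuraPeriodsGamma1
import Literature.NumberTheory.EllipticCurves.CuspFormLFunction
import HarnessLib

/-!
# The complex untwist symbol of an `α`-stabilised twist: `ℤ`-periodicity, the `p`-deprivation
# identity in the rational plus symbols of `f`, and transfer of lattice values

Cell `pub/bsd-wall` (D-0145 line `route-BirchSwinnertonDyer-CyclotomicUntwist`), seat `bsd-line-cycu-p3`
(prover seat 3/3, gen 9). THEOREMS ONLY (no definition, no named fact, no `sorry`); helper toward the crux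
child C1 = stmt-BirchSwinnertonDyer-27548 (`PSUntwistedLFunctionAtThree`) — it supplies the complex-side
hypotheses `hΨper`, `hΨrec` and the lattice clause of `PSF1OfLattice.exists_isPSCyclotomicLFunctionOf_of_lattice`
(files `CyclotomicUntwistF1OfLatticeGrowth` / `CyclotomicUntwistF1OfLattice` of this seat). BSD is not proved
by this file; no crux and no child of the route is proved by it; K1/K2 stay OPEN and WHOLE.

SETTING. `f ∈ S₂(Γ₀(N))` (intended: the newform of `W`), a prime `p`, a Dirichlet character `η` mod `p^c`
with complex values, `α, κ ∈ ℂ`, and a weight-`2` cusp form `G` on some `Γ₁(L)` — the `α`-STABILISED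
UNTWIST — tied to `f` by the functional identity
(★) `G(τ) − α·G(pτ) = κ · ∑_{u mod p^c} η(u) f(τ + u/p^c)` on `ℍ`
(for the route: `G = g₀` the newform of `f ⊗ η̄` of level `9M`, `U₃ g₀ = α g₀`, so that
`g₀ − α g₀(3·) = f ⊗ η̄ = τ(η)⁻¹ ∑_u η(u) f(· + u/9)`; this file does not construct `G`).  The ray integrals
`Ψ_G(r) = 2π ∫₀^∞ G(r + it) dt` (`r ∈ ℚ`) are carried as a function `Ψ_G` with its defining
hypothesis-equation (`hΨG`), the tree's idiom for a construction without a `def`; integrability of the rays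
(`hGint`) is a hypothesis here (it holds for every cusp form on a finite-index level; sequel file).

* §1 `raySymbol_add_intCast` — `Ψ_G(r + n) = Ψ_G(r)` (`T ∈ Γ₁(L)`: `G ∘ ofComplex` is `1`-periodic,
  `isCuspFunction_one_gamma1`).
* §2 `raySymbol_sub_eq_sum_modularSymbol` — integrating (★) along the ray above `r`, with the
  substitution `t ↦ pt` on the `G(p·)` term: `Ψ_G(r) − (α/p) Ψ_G(pr) = κ ∑_u η(u) {∞, r + u/p^c}_f`.
* §3 `psi_sub_eq_sum_ratPlusSymbol` — for the SIGNED symmetrisation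
  `Ψ(r) = (Ψ_G(r) + η(−1) Ψ_G(−r)) / (2 κ Ω⁺_f)` and a rational newform `f`
  (`IsNewform0 f`, `coeffField f = ⊥`, so `plusSymbol f r = [r]⁺_f · Ω⁺_f`, `ratCast_ratPlusSymbol_mul_plusPeriod`):
  `Ψ(r) − (α/p)Ψ(pr) = ∑_u η(u) [r + u/p^c]⁺_f` — EXACTLY the hypothesis `hΨrec` of `PSF1OfLattice`
  (the deprivation identity (S3) of `PSUntwistExistence`); `psi_add_intCast` — `Ψ` is `ℤ`-periodic.
* §4 `exists_fg_forall_psi_mem` — if the `Ψ_G(r)` lie in a finitely generated `ℤ`-submodule of `ℂ`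
  then so do the `Ψ(r)` (`η(−1) = ±1`; scale by `(2κΩ⁺_f)⁻¹`).

References: [cite: MazurTateTeitelbaum1986Invent, §I.4 (4.2), §I.8 and §I.10] ·
[cite: Shimura1971, Prop. 3.64] · [cite: Manin1972, §1.5].
-/

noncomputable section

open scoped MatrixGroups

open CongruenceSubgroup UpperHalfPlane Complex MeasureTheory Set
  Literature.NumberTheory.EllipticCurves Literature.NumberTheory.EllipticCurves.ModularForms

-- single-conjunct summit: `Summit.BirchSwinnertonDyer.BirchSwinnertonDyer.…` repeats the name by design
set_option linter.dupNamespace false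
set_option autoImplicit false

namespace Summit.BirchSwinnertonDyer.BirchSwinnertonDyer.Theorems.PSStabilisedTwist

/-! ### §1 The ray symbol of a `Γ₁(L)` cusp form is `ℤ`-periodic -/

section Periodic

variable {L : ℕ} [NeZero L] (G : CuspForm (Gamma1 L) 2)
variable (ΨG : ℚ → ℂ)
variable (hΨG : ∀ r : ℚ, ΨG r = 2 * Real.pi * ∫ t in Ioi (0 : ℝ), G (ofComplex ((r : ℂ) + t * Complex.I)))

include hΨG in
/-- **`Ψ_G(r + n) = Ψ_G(r)`**: `G(z + 1) = G(z)` since `T ∈ Γ₁(L)` (`isCuspFunction_one_gamma1`), so the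
rays above `r` and `r + n` carry the same integrand. [cite: MazurTateTeitelbaum1986Invent, §I.4 (4.2)] -/
theorem raySymbol_add_intCast (r : ℚ) (n : ℤ) : ΨG (r + n) = ΨG r := by
  have hper := (isCuspFunction_one_gamma1 G).periodic.int_mul n
  rw [hΨG, hΨG]
  congr 1
  refine setIntegral_congr_fun measurableSet_Ioi fun t _ ↦ ?_
  have := hper ((r : ℂ) + t * Complex.I)
  simp only [Function.comp_apply] at this
  rw [← this]
  push_cast
  ring_nf

end Periodic

/-! ### §2 Integrating the stabilisation identity along a ray -/

section Ray

variable {p : ℕ} [Fact p.Prime]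
variable {N : ℕ} [NeZero N] (f : CuspForm (Gamma0 N) 2)
variable {c : ℕ} (η : DirichletCharacter ℂ (p ^ c)) (α κ : ℂ)
variable {L : ℕ} [NeZero L] (G : CuspForm (Gamma1 L) 2)
variable (hG : ∀ τ : ℍ, G τ - α * G (ofComplex ((p : ℂ) * (τ : ℂ))) =
  κ * ∑ u : ZMod (p ^ c), η u * f ((((u.val : ℚ) / (p : ℚ) ^ c : ℚ) : ℝ) +ᵥ τ))
variable (hGint : ∀ r : ℚ, IntegrableOn (fun t : ℝ ↦ G (ofComplex ((r : ℂ) + t * Complex.I))) (Ioi 0))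
variable (ΨG : ℚ → ℂ)
variable (hΨG : ∀ r : ℚ, ΨG r = 2 * Real.pi * ∫ t in Ioi (0 : ℝ), G (ofComplex ((r : ℂ) + t * Complex.I)))

omit [Fact p.Prime] in
/-- Translating the ray above `r` by the rational `q`: `q +ᵥ (r + it) = (r + q) + it` (`t > 0`). [folklore] -/
theorem ratCast_vadd_ofComplex (q r : ℚ) {t : ℝ} (ht : 0 < t) :
    (((q : ℝ)) +ᵥ ofComplex ((r : ℂ) + t * Complex.I) : ℍ) = ofComplex (((r + q : ℚ) : ℂ) + t * Complex.I) := by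
  have h1 : 0 < ((r : ℂ) + t * Complex.I).im := by simpa using ht
  have h2 : 0 < (((r + q : ℚ) : ℂ) + t * Complex.I).im := by simpa using ht
  rw [ofComplex_apply_of_im_pos h1, ofComplex_apply_of_im_pos h2]
  ext1
  simp only [coe_vadd, Complex.ofReal_ratCast]
  push_cast
  ring

omit [Fact p.Prime] in
/-- Scaling the ray above `r` by `p`: `p · (r + it) = pr + i(pt)` (`t > 0`). [folklore] -/
theorem ofComplex_natCast_mul_ofComplex (r : ℚ) {t : ℝ} (ht : 0 < t) :
    ofComplex ((p : ℂ) * ((ofComplex ((r : ℂ) + t * Complex.I) : ℍ) : ℂ)) =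
      ofComplex ((((p : ℚ) * r : ℚ) : ℂ) + (((p : ℝ) * t : ℝ) : ℂ) * Complex.I) := by
  have h1 : 0 < ((r : ℂ) + t * Complex.I).im := by simpa using ht
  rw [ofComplex_apply_of_im_pos h1]
  congr 1
  push_cast
  ring

omit [NeZero L] in
include hG hGint hΨG in
/-- **The deprivation identity along a ray**: integrating (★) `G − αG(p·) = κ ∑_u η(u) f(· + u/p^c)` over
the vertical ray above `r ∈ ℚ` and substituting `t ↦ pt` in the `G(p·)` term,
`Ψ_G(r) − (α/p)·Ψ_G(pr) = κ · ∑_{u mod p^c} η(u) {∞, r + u/p^c}_f`.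
[cite: MazurTateTeitelbaum1986Invent, §I.10] [cite: Shimura1971, Prop. 3.64] -/
theorem raySymbol_sub_eq_sum_modularSymbol (r : ℚ) :
    ΨG r - α / p * ΨG (p * r) =
      κ * ∑ u : ZMod (p ^ c), η u * modularSymbol f (r + (u.val : ℚ) / (p : ℚ) ^ c) := by
  have hp : p.Prime := Fact.out
  have hp0 : (0 : ℝ) < p := by exact_mod_cast hp.pos
  have hpC : (p : ℂ) ≠ 0 := by exact_mod_cast hp.ne_zero
  -- the integrands
  set FG : ℝ → ℂ := fun t ↦ G (ofComplex ((r : ℂ) + t * Complex.I)) with hFG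
  set FGp : ℝ → ℂ := fun t ↦ G (ofComplex ((((p : ℚ) * r : ℚ) : ℂ) + t * Complex.I)) with hFGp
  set Ff : ZMod (p ^ c) → ℝ → ℂ := fun u t ↦
    f (ofComplex (((r + (u.val : ℚ) / (p : ℚ) ^ c : ℚ) : ℂ) + t * Complex.I)) with hFf
  -- pointwise form of (★) on the ray
  have hpt : ∀ t ∈ Ioi (0 : ℝ), FG t = α * FGp ((p : ℝ) * t) + κ * ∑ u : ZMod (p ^ c), η u * Ff u t := by
    intro t ht
    have h := hG (ofComplex ((r : ℂ) + t * Complex.I))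
    rw [ofComplex_natCast_mul_ofComplex r ht] at h
    have hsum : ∑ u : ZMod (p ^ c), η u * f ((((u.val : ℚ) / (p : ℚ) ^ c : ℚ) : ℝ) +ᵥ
        ofComplex ((r : ℂ) + t * Complex.I)) = ∑ u : ZMod (p ^ c), η u * Ff u t := by
      refine Finset.sum_congr rfl fun u _ ↦ ?_
      rw [ratCast_vadd_ofComplex _ r ht]
    rw [hsum] at h
    simp only [hFG, hFGp]
    push_cast at h ⊢
    linear_combination h
  -- integrability of the pieces
  have hIG : IntegrableOn FG (Ioi 0) := hGint r
  have hIGp : IntegrableOn (fun t : ℝ ↦ FGp ((p : ℝ) * t)) (Ioi 0) := by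
    rw [integrableOn_Ioi_comp_mul_left_iff FGp 0 hp0, mul_zero]
    exact hGint _
  have hIf : ∀ u : ZMod (p ^ c), IntegrableOn (Ff u) (Ioi 0) := fun u ↦
    integrableOn_modularSymbol_integrand_holds f _
  have hIsum : IntegrableOn (fun t : ℝ ↦ ∑ u : ZMod (p ^ c), η u * Ff u t) (Ioi 0) :=
    integrable_finsetSum _ fun u _ ↦ (hIf u).const_mul _
  -- integrate
  have hint : ∫ t in Ioi (0 : ℝ), FG t =
      α * ((p : ℂ)⁻¹ * ∫ t in Ioi (0 : ℝ), FGp t) +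
        κ * ∑ u : ZMod (p ^ c), η u * ∫ t in Ioi (0 : ℝ), Ff u t := by
    rw [setIntegral_congr_fun measurableSet_Ioi hpt, integral_add (hIGp.const_mul α) (hIsum.const_mul κ),
      integral_const_mul, integral_const_mul, integral_comp_mul_left_Ioi FGp 0 hp0, mul_zero,
      integral_finsetSum _ fun u _ ↦ (hIf u).const_mul _]
    congr 2
    · rw [Complex.real_smul]
      push_cast
      ring
    · exact Finset.sum_congr rfl fun u _ ↦ integral_const_mul _ _
  have h1 : ΨG r = 2 * Real.pi * ∫ t in Ioi (0 : ℝ), FG t := hΨG r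
  have h2 : ΨG ((p : ℚ) * r) = 2 * Real.pi * ∫ t in Ioi (0 : ℝ), FGp t := hΨG _
  have hms : ∀ u : ZMod (p ^ c), modularSymbol f (r + (u.val : ℚ) / (p : ℚ) ^ c) =
      2 * Real.pi * ∫ t in Ioi (0 : ℝ), Ff u t := fun u ↦ rfl
  rw [h1, h2, hint, Finset.sum_congr rfl fun u (_ : u ∈ Finset.univ) ↦ congrArg (η u * ·) (hms u)]
  rw [show (∑ u : ZMod (p ^ c), η u * (2 * (Real.pi : ℂ) * ∫ t in Ioi (0 : ℝ), Ff u t)) =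
      2 * Real.pi * ∑ u : ZMod (p ^ c), η u * ∫ t in Ioi (0 : ℝ), Ff u t by
    rw [Finset.mul_sum]; exact Finset.sum_congr rfl fun u _ ↦ by ring]
  field_simp
  ring

end Ray

/-! ### §3 The signed symmetrisation: the deprivation identity in the rational plus symbols of `f` -/

section Plus

variable {p : ℕ} [Fact p.Prime]
variable {N : ℕ} [NeZero N] (f : CuspForm (Gamma0 N) 2)
variable {c : ℕ} (η : DirichletCharacter ℂ (p ^ c)) (α κ : ℂ)
variable {L : ℕ} [NeZero L] (G : CuspForm (Gamma1 L) 2)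
variable (hG : ∀ τ : ℍ, G τ - α * G (ofComplex ((p : ℂ) * (τ : ℂ))) =
  κ * ∑ u : ZMod (p ^ c), η u * f ((((u.val : ℚ) / (p : ℚ) ^ c : ℚ) : ℝ) +ᵥ τ))
variable (hGint : ∀ r : ℚ, IntegrableOn (fun t : ℝ ↦ G (ofComplex ((r : ℂ) + t * Complex.I))) (Ioi 0))
variable (ΨG : ℚ → ℂ)
variable (hΨG : ∀ r : ℚ, ΨG r = 2 * Real.pi * ∫ t in Ioi (0 : ℝ), G (ofComplex ((r : ℂ) + t * Complex.I)))
variable (Ψ : ℚ → ℂ)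
variable (hΨ : ∀ r : ℚ, Ψ r = (ΨG r + η (-1) * ΨG (-r)) / (2 * κ * (plusPeriod f : ℂ)))

/-- The `u ↦ −u` re-indexing: `∑_u η(u) {∞, −r + u/p^c}_f = η(−1) ∑_u η(u) {∞, −(r + u/p^c)}_f`
(`{∞, −r + (−u)/p^c} = {∞, −(r + u/p^c)}`, the cusps differing by an integer).
[cite: MazurTateTeitelbaum1986Invent, §I.8] -/
theorem sum_mul_modularSymbol_neg_add (r : ℚ) :
    ∑ u : ZMod (p ^ c), η u * modularSymbol f (-r + (u.val : ℚ) / (p : ℚ) ^ c) =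
      η (-1) * ∑ u : ZMod (p ^ c), η u * modularSymbol f (-(r + (u.val : ℚ) / (p : ℚ) ^ c)) := by
  have hshift : ∀ u : ZMod (p ^ c), (u.val : ℚ) / (p : ℚ) ^ c = twistShift u := fun u ↦ by
    rw [twistShift]; push_cast; rfl
  rw [Finset.mul_sum]
  refine Fintype.sum_equiv (Equiv.neg _) _ _ fun u ↦ ?_
  have hms := modularSymbol_neg_add_twistShift_neg f r (-u)
  rw [neg_neg] at hms
  rw [Equiv.neg_apply, ← mul_assoc, ← map_mul, neg_one_mul, neg_neg, hshift, hshift, hms]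

omit [NeZero L] in
include hG hGint hΨG hΨ in
/-- **The `p`-deprivation identity in the rational plus symbols of `f`** — EXACTLY the hypothesis `hΨrec`
of `PSF1OfLattice`: for a rational newform `f` (`IsNewform0 f`, `coeffField f = ⊥`), `κ ≠ 0`, and the
signed symmetrisation `Ψ(r) = (Ψ_G(r) + η(−1)Ψ_G(−r))/(2κΩ⁺_f)` of the ray symbol of the `α`-stabilised
untwist `G`:  `Ψ(r) − (α/p)Ψ(pr) = ∑_{u mod p^c} η(u) [r + u/p^c]⁺_f`.
Proof: §2 at `r` and `−r`, the re-indexing `u ↦ −u`, and `plusSymbol f s = [s]⁺_f Ω⁺_f`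
(`ratCast_ratPlusSymbol_mul_plusPeriod`). [cite: MazurTateTeitelbaum1986Invent, §I.8 and §I.10]
[cite: Shimura1971, Prop. 3.64] -/
theorem psi_sub_eq_sum_ratPlusSymbol (hf : IsNewform0 f) (hQ : coeffField f = ⊥) (hκ : κ ≠ 0) (r : ℚ) :
    Ψ r - α / p * Ψ (p * r) =
      ∑ u : ZMod (p ^ c), η u * ((ratPlusSymbol f (r + (u.val : ℚ) / (p : ℚ) ^ c) : ℚ) : ℂ) := by
  have hΩ : (plusPeriod f : ℂ) ≠ 0 := by exact_mod_cast (IsNewform0.plusPeriod_pos_holds hf hQ).ne'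
  have hr := raySymbol_sub_eq_sum_modularSymbol f η α κ G hG hGint ΨG hΨG r
  have hnr := raySymbol_sub_eq_sum_modularSymbol f η α κ G hG hGint ΨG hΨG (-r)
  rw [mul_neg, sum_mul_modularSymbol_neg_add f η r] at hnr
  have hplus : ∀ u : ZMod (p ^ c), modularSymbol f (r + (u.val : ℚ) / (p : ℚ) ^ c) +
      modularSymbol f (-(r + (u.val : ℚ) / (p : ℚ) ^ c)) =
        2 * (((ratPlusSymbol f (r + (u.val : ℚ) / (p : ℚ) ^ c) : ℚ) : ℂ) * (plusPeriod f : ℂ)) := fun u ↦ by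
    rw [ratCast_ratPlusSymbol_mul_plusPeriod f hf hQ, plusSymbol]; ring
  have hkey : (ΨG r - α / p * ΨG (p * r)) + η (-1) * (ΨG (-r) - α / p * ΨG (-(p * r))) =
      2 * κ * (plusPeriod f : ℂ) *
        ∑ u : ZMod (p ^ c), η u * ((ratPlusSymbol f (r + (u.val : ℚ) / (p : ℚ) ^ c) : ℚ) : ℂ) := by
    have hη1 : η (-1) * η (-1) = 1 := by rw [← map_mul, neg_mul_neg, mul_one, map_one]
    rw [hr, hnr, ← mul_assoc (η (-1)), mul_comm (η (-1)) κ, mul_assoc κ, ← mul_assoc (η (-1)),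
      hη1, one_mul, ← mul_add, ← Finset.sum_add_distrib, Finset.mul_sum, Finset.mul_sum]
    refine Finset.sum_congr rfl fun u _ ↦ ?_
    rw [← mul_add, hplus]
    ring
  have h2 : (2 * κ * (plusPeriod f : ℂ)) ≠ 0 := mul_ne_zero (mul_ne_zero two_ne_zero hκ) hΩ
  rw [hΨ, hΨ, mul_div_assoc', div_sub_div_same, div_eq_iff h2]
  linear_combination hkey

omit [Fact p.Prime] [NeZero N] in
include hΨG hΨ in
/-- **`Ψ` is `ℤ`-periodic** (from §1). [cite: MazurTateTeitelbaum1986Invent, §I.4 (4.2)] -/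
theorem psi_add_intCast (r : ℚ) (n : ℤ) : Ψ (r + n) = Ψ r := by
  rw [hΨ, hΨ, raySymbol_add_intCast G ΨG hΨG r n, neg_add, ← Int.cast_neg,
    raySymbol_add_intCast G ΨG hΨG (-r) (-n)]

/-! ### §4 Lattice values transfer from `Ψ_G` to `Ψ` -/

omit [Fact p.Prime] [NeZero N] [NeZero L] in
include hΨ in
/-- **Lattice transfer**: if every `Ψ_G(r)` lies in a finitely generated `ℤ`-submodule `Λ_G ⊆ ℂ`, then every
`Ψ(r)` lies in the finitely generated `ℤ`-submodule `(2κΩ⁺_f)⁻¹ · Λ_G` (`η(−1) = ±1`). [cite: Manin1972, §1.5] -/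
theorem exists_fg_forall_psi_mem {ΛG : Submodule ℤ ℂ} (hΛG : ΛG.FG) (hmem : ∀ r : ℚ, ΨG r ∈ ΛG) :
    ∃ Λ : Submodule ℤ ℂ, Λ.FG ∧ ∀ r : ℚ, Ψ r ∈ Λ := by
  refine ⟨ΛG.map (LinearMap.mulLeft ℤ ((2 * κ * (plusPeriod f : ℂ))⁻¹)), hΛG.map _, fun r ↦ ?_⟩
  rw [Submodule.mem_map]
  refine ⟨ΨG r + η (-1) * ΨG (-r), ?_, ?_⟩
  · have hη1 : η (-1) * η (-1) = 1 := by rw [← map_mul, neg_mul_neg, mul_one, map_one]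
    have hsq : η (-1) = 1 ∨ η (-1) = -1 := mul_self_eq_one_iff.mp hη1
    rcases hsq with h | h
    · rw [h, one_mul]; exact ΛG.add_mem (hmem r) (hmem (-r))
    · rw [h, neg_one_mul]; exact ΛG.add_mem (hmem r) (ΛG.neg_mem (hmem (-r)))
  · rw [LinearMap.mulLeft_apply, hΨ, div_eq_inv_mul]

end Plus

end Summit.BirchSwinnertonDyer.BirchSwinnertonDyer.Theorems.PSStabilisedTwist

end
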